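import Mathlib
import Summits.AtomisticToContinuum.Crystallization.Theorems.ChessboardParticlePlanesLjLaminarWindowsMinDistDefs
import Literature.MathematicalPhysics.StatisticalMechanics.Yuhjtman2015Theta
import HarnessLib

/-!
# One-variable facts about the majorant `thetaF` of the charged minus-energy

Stub `stub_forceTheta` of line `Sketch`, crux `LjLaminarWindows` (stmt-AtomisticToContinuum-6711):
the seven conjuncts (a)–(g) of `ForceThetaFacts` for the radial majorant `thetaF` of the charged
minus-energy `kF = h + (1/25)|h'|` (`h = hLJ`, `h' = hLJ'`), after `Yuhjtman2015Theta.lean` /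
`Yuhjtman2015Proofs.lean` with Yuhjtman's tangent data `(w₀, A, B, g)` replaced by
`(3/2, AF, BF, G)`, `G(v) = v kF(v) = 2v⁻⁵ - v⁻¹¹ + (12/25)(v⁻⁶ - v⁻¹²)` for `v ≥ 1`.
(a) convexity of `gamF`: the line `AF - BF v` (`v ≤ 3/2`) meets `G` (`v ≥ 3/2`) exactly at `3/2`,
`G'' ≥ 0` and `G'(3/2⁺) > -BF`, so `gamF` has a supporting line at every `r > 0`; (b), (f):
polynomial inequalities with positive Bernstein coefficients after clearing `v¹³` (one `linarith`
call with the Bernstein hint list); (c), (d), (e): elementary; (g): explicit antiderivatives,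
`∫_{16/25}^{3/2} = 266031117181/295245000000`, `∫_{3/2}^{∞} = 4816448/22143375`, sum `≤ 28/25`.
-/

noncomputable section

open MeasureTheory intervalIntegral Set Literature.MathematicalPhysics.StatisticalMechanics
open Literature.MathematicalPhysics.StatisticalMechanics.Yuhjtman2015

namespace Summit.AtomisticToContinuum.Crystallization.Theorems.LjLaminarWindowsSketch

/-- `h'(v) ≥ 0` for `0 < v ≤ 1`. [folklore] -/
theorem forceTheta_hLJ'_nonneg {v : ℝ} (hv : 0 < v) (hv1 : v ≤ 1) : 0 ≤ hLJ' v := by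
  unfold hLJ'
  have h6 : 1 ≤ v⁻¹ ^ 6 := one_le_pow₀ ((one_le_inv₀ hv).2 hv1)
  linarith [mul_le_mul_of_nonneg_left h6 (by positivity : (0 : ℝ) ≤ 12 * v⁻¹ ^ 7)]

/-- `h'(v) ≤ 0` for `1 ≤ v`. [folklore] -/
theorem forceTheta_hLJ'_nonpos {v : ℝ} (hv1 : 1 ≤ v) : hLJ' v ≤ 0 := by
  unfold hLJ'
  have h0 : 0 ≤ v⁻¹ := inv_nonneg.2 (by linarith)
  have h13 : v⁻¹ ^ 13 ≤ v⁻¹ ^ 7 := pow_le_pow_of_le_one h0 (inv_le_one_of_one_le₀ hv1) (by norm_num)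
  linarith

/-- `kF(v) = (2v⁷ - v + (12/25)(1 - v⁶)) / v¹³` for `0 < v ≤ 1`. [folklore] -/
theorem forceTheta_kF_of_le_one {v : ℝ} (hv : 0 < v) (hv1 : v ≤ 1) :
    kF v = (2 * v ^ 7 - v + 12 / 25 * (1 - v ^ 6)) / v ^ 13 := by
  rw [kF, abs_of_nonneg (forceTheta_hLJ'_nonneg hv hv1), hLJ, hLJ']
  field_simp

/-- `kF(v) = (2v⁷ - v + (12/25)(v⁶ - 1)) / v¹³` for `1 ≤ v`. [folklore] -/
theorem forceTheta_kF_of_one_le {v : ℝ} (hv1 : 1 ≤ v) :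
    kF v = (2 * v ^ 7 - v + 12 / 25 * (v ^ 6 - 1)) / v ^ 13 := by
  have hv : 0 < v := by linarith
  rw [kF, abs_of_nonpos (forceTheta_hLJ'_nonpos hv1), hLJ, hLJ']
  field_simp
  ring

/-- `thetaF` on `(-∞, 3/2]`. [folklore] -/
theorem forceTheta_thetaF_of_le {v : ℝ} (h : v ≤ 3 / 2) : thetaF v = AF / v - BF := if_pos h

/-- `thetaF` on `[3/2, ∞)`; at `3/2` this is the **junction identity**
`kF(3/2) = AF/(3/2) - BF` (`= 171392/885735`; `thetaF` is continuous at `3/2`). [folklore] -/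
theorem forceTheta_thetaF_of_ge {v : ℝ} (h : 3 / 2 ≤ v) : thetaF v = kF v := by
  rcases h.eq_or_lt with h1 | h1
  · rw [← h1, forceTheta_thetaF_of_le le_rfl]
    unfold kF hLJ hLJ' AF BF
    rw [abs_of_nonpos (by norm_num)]
    norm_num
  · exact if_neg (not_le.2 h1)

/-- `gamF` on `(0, 3/2]`: the line `AF - BF v`. [folklore] -/
theorem forceTheta_gamF_of_le {v : ℝ} (hv : 0 < v) (h : v ≤ 3 / 2) : gamF v = AF - BF * v := by
  rw [gamF, forceTheta_thetaF_of_le h]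
  field_simp

/-- `gamF` on `[3/2, ∞)`: `gamF(v) = G(v) = 2v⁻⁵ - v⁻¹¹ + (12/25)(v⁻⁶ - v⁻¹²)`. [folklore] -/
theorem forceTheta_gamF_of_ge {v : ℝ} (h : 3 / 2 ≤ v) :
    gamF v = 2 * v⁻¹ ^ 5 - v⁻¹ ^ 11 + 12 / 25 * (v⁻¹ ^ 6 - v⁻¹ ^ 12) := by
  have hv : 0 < v := lt_of_lt_of_le (by norm_num) h
  rw [gamF, forceTheta_thetaF_of_ge h, kF, abs_of_nonpos (forceTheta_hLJ'_nonpos (by linarith)),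
    hLJ, hLJ']
  field_simp
  ring

/-- `G' (v) = -10v⁻⁶ + 11v⁻¹² + (12/25)(-6v⁻⁷ + 12v⁻¹³)` away from `0`. [folklore] -/
theorem forceTheta_hasDerivAt_G {v : ℝ} (hv : v ≠ 0) :
    HasDerivAt (fun x : ℝ ↦ 2 * x⁻¹ ^ 5 - x⁻¹ ^ 11 + 12 / 25 * (x⁻¹ ^ 6 - x⁻¹ ^ 12))
      (-10 * v⁻¹ ^ 6 + 11 * v⁻¹ ^ 12 + 12 / 25 * (-6 * v⁻¹ ^ 7 + 12 * v⁻¹ ^ 13)) v := by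
  have hi : HasDerivAt (fun y : ℝ ↦ y⁻¹) (-(v ^ 2)⁻¹) v := hasDerivAt_inv hv
  have h := (((hi.fun_pow 5).const_mul 2).fun_sub (hi.fun_pow 11)).fun_add
    (((hi.fun_pow 6).fun_sub (hi.fun_pow 12)).const_mul (12 / 25))
  refine h.congr_deriv ?_
  norm_num
  field_simp
  ring

/-- `G''(v) = 60v⁻⁷ - 132v⁻¹³ + (12/25)(42v⁻⁸ - 156v⁻¹⁴)` away from `0`. [folklore] -/
theorem forceTheta_hasDerivAt_dG {v : ℝ} (hv : v ≠ 0) :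
    HasDerivAt (fun x : ℝ ↦ -10 * x⁻¹ ^ 6 + 11 * x⁻¹ ^ 12 + 12 / 25 * (-6 * x⁻¹ ^ 7 + 12 * x⁻¹ ^ 13))
      (60 * v⁻¹ ^ 7 - 132 * v⁻¹ ^ 13 + 12 / 25 * (42 * v⁻¹ ^ 8 - 156 * v⁻¹ ^ 14)) v := by
  have hi : HasDerivAt (fun y : ℝ ↦ y⁻¹) (-(v ^ 2)⁻¹) v := hasDerivAt_inv hv
  have h := ((((hi.fun_pow 6).const_mul (-10)).fun_add ((hi.fun_pow 12).const_mul 11))).fun_add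
    ((((hi.fun_pow 7).const_mul (-6)).fun_add ((hi.fun_pow 13).const_mul 12)).const_mul (12 / 25))
  refine h.congr_deriv ?_
  norm_num
  field_simp
  ring

/-- `gamF' = G'` on `(3/2, ∞)`. [folklore] -/
theorem forceTheta_hasDerivAt_gamF {x : ℝ} (hx : 3 / 2 < x) :
    HasDerivAt gamF (-10 * x⁻¹ ^ 6 + 11 * x⁻¹ ^ 12 + 12 / 25 * (-6 * x⁻¹ ^ 7 + 12 * x⁻¹ ^ 13)) x := by
  refine (forceTheta_hasDerivAt_G (lt_trans (by norm_num) hx).ne').congr_of_eventuallyEq ?_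
  filter_upwards [Ioi_mem_nhds hx] with y hy
  exact forceTheta_gamF_of_ge (le_of_lt hy)

/-- The right derivative of `gamF` at `3/2` is `G'(3/2)` (`= -12383872/13286025`). [folklore] -/
theorem forceTheta_hasDerivWithinAt_gamF :
    HasDerivWithinAt gamF (-10 * (3 / 2 : ℝ)⁻¹ ^ 6 + 11 * (3 / 2 : ℝ)⁻¹ ^ 12 +
      12 / 25 * (-6 * (3 / 2 : ℝ)⁻¹ ^ 7 + 12 * (3 / 2 : ℝ)⁻¹ ^ 13)) (Ioi (3 / 2)) (3 / 2) :=
  (forceTheta_hasDerivAt_G (by norm_num)).hasDerivWithinAt.congr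
    (fun _ hy ↦ forceTheta_gamF_of_ge (le_of_lt hy)) (forceTheta_gamF_of_ge le_rfl)

/-- **`gamF` is convex on `[3/2, ∞)`**: `G'' = v⁻⁷ [60 - 132 p⁶ + (12/25)(42 p - 156 p⁷)] ≥ 0`
with `p = v⁻¹ ≤ 2/3`. [folklore] -/
theorem forceTheta_convexOn_gamF : ConvexOn ℝ (Ici (3 / 2)) gamF := by
  have hD : interior (Ici (3 / 2 : ℝ)) = Ioi (3 / 2) := interior_Ici
  refine convexOn_of_hasDerivWithinAt2_nonneg (convex_Ici _)
    (f' := fun v ↦ -10 * v⁻¹ ^ 6 + 11 * v⁻¹ ^ 12 + 12 / 25 * (-6 * v⁻¹ ^ 7 + 12 * v⁻¹ ^ 13))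
    (f'' := fun v ↦ 60 * v⁻¹ ^ 7 - 132 * v⁻¹ ^ 13 + 12 / 25 * (42 * v⁻¹ ^ 8 - 156 * v⁻¹ ^ 14))
    ?_ ?_ ?_ ?_
  · have hG : ContinuousOn (fun x : ℝ ↦ 2 * x⁻¹ ^ 5 - x⁻¹ ^ 11 + 12 / 25 * (x⁻¹ ^ 6 - x⁻¹ ^ 12))
        (Ici (3 / 2)) := fun v hv ↦ (forceTheta_hasDerivAt_G
          (lt_of_lt_of_le (by norm_num) hv).ne').continuousAt.continuousWithinAt
    exact hG.congr fun v hv ↦ forceTheta_gamF_of_ge hv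
  · intro v hv
    rw [hD] at hv ⊢
    exact (forceTheta_hasDerivAt_gamF hv).hasDerivWithinAt
  · intro v hv
    rw [hD] at hv ⊢
    exact (forceTheta_hasDerivAt_dG
      (lt_trans (by norm_num) (show (3 : ℝ) / 2 < v from hv)).ne').hasDerivWithinAt
  · intro v hv
    rw [hD] at hv
    have hv' : (3 : ℝ) / 2 < v := hv
    have hv0 : 0 < v := lt_trans (by norm_num) hv'
    have hp0 : 0 ≤ v⁻¹ := inv_nonneg.2 hv0.le
    have hp1 : v⁻¹ ≤ 2 / 3 := by rw [inv_le_comm₀ hv0 (by norm_num)]; norm_num; exact hv'.le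
    have hp6 : v⁻¹ ^ 6 ≤ 64 / 729 := (pow_le_pow_left₀ hp0 hp1 6).trans (by norm_num)
    have hp7 : v⁻¹ ^ 7 ≤ 128 / 2187 := (pow_le_pow_left₀ hp0 hp1 7).trans (by norm_num)
    have key : (60 * v⁻¹ ^ 7 - 132 * v⁻¹ ^ 13 + 12 / 25 * (42 * v⁻¹ ^ 8 - 156 * v⁻¹ ^ 14) : ℝ) =
        v⁻¹ ^ 7 * (60 - 132 * v⁻¹ ^ 6 + 12 / 25 * (42 * v⁻¹ - 156 * v⁻¹ ^ 7)) := by ring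
    show 0 ≤ 60 * v⁻¹ ^ 7 - 132 * v⁻¹ ^ 13 + 12 / 25 * (42 * v⁻¹ ^ 8 - 156 * v⁻¹ ^ 14)
    rw [key]
    exact mul_nonneg (by positivity) (by linarith)

/-- **Tangents of the convex branch**: `gamF(r) + G'(r)(v - r) ≤ gamF(v)`, `r > 3/2`, `v ≥ 3/2`. [folklore] -/
theorem forceTheta_tangent_le {r v : ℝ} (hr : 3 / 2 < r) (hv : 3 / 2 ≤ v) :
    gamF r + (-10 * r⁻¹ ^ 6 + 11 * r⁻¹ ^ 12 + 12 / 25 * (-6 * r⁻¹ ^ 7 + 12 * r⁻¹ ^ 13)) * (v - r)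
      ≤ gamF v := by
  rcases lt_trichotomy r v with hlt | rfl | hgt
  · have h := forceTheta_convexOn_gamF.le_slope_of_hasDerivAt (mem_Ici.2 hr.le) (mem_Ici.2 hv) hlt
      (forceTheta_hasDerivAt_gamF hr)
    rw [slope_def_field, le_div_iff₀ (by linarith)] at h
    linarith
  · simp
  · have h := forceTheta_convexOn_gamF.slope_le_of_hasDerivAt (mem_Ici.2 hv) (mem_Ici.2 hr.le) hgt
      (forceTheta_hasDerivAt_gamF hr)
    rw [slope_def_field, div_le_iff₀ (by linarith)] at h
    linarith

/-- `-BF ≤ G'(3/2)` (`-37/20 < -12383872/13286025`). [folklore] -/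
theorem forceTheta_neg_BF_le : -BF ≤ -10 * (3 / 2 : ℝ)⁻¹ ^ 6 + 11 * (3 / 2 : ℝ)⁻¹ ^ 12 +
    12 / 25 * (-6 * (3 / 2 : ℝ)⁻¹ ^ 7 + 12 * (3 / 2 : ℝ)⁻¹ ^ 13) := by
  unfold BF
  norm_num

/-- `G' ≥ -BF` on `(3/2, ∞)` (slopes of the convex `gamF` increase: `G'(r) ≥ G'(3/2⁺) ≥ -BF`). [folklore] -/
theorem forceTheta_neg_BF_le_deriv {r : ℝ} (hr : 3 / 2 < r) :
    -BF ≤ -10 * r⁻¹ ^ 6 + 11 * r⁻¹ ^ 12 + 12 / 25 * (-6 * r⁻¹ ^ 7 + 12 * r⁻¹ ^ 13) := by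
  have h1 := forceTheta_convexOn_gamF.le_slope_of_hasDerivWithinAt_Ioi self_mem_Ici
    (mem_Ici.2 hr.le) hr forceTheta_hasDerivWithinAt_gamF
  have h2 := forceTheta_convexOn_gamF.slope_le_of_hasDerivAt self_mem_Ici (mem_Ici.2 hr.le) hr
    (forceTheta_hasDerivAt_gamF hr)
  exact forceTheta_neg_BF_le.trans (h1.trans h2)

/-- **The line lies below the convex branch**: `AF - BF v ≤ gamF(v)` for `v ≥ 3/2`. [folklore] -/
theorem forceTheta_line_le_gamF {v : ℝ} (hv : 3 / 2 ≤ v) : AF - BF * v ≤ gamF v := by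
  rcases hv.eq_or_lt with h | h
  · rw [← h, forceTheta_gamF_of_le (by norm_num) le_rfl]
  · have h1 := forceTheta_convexOn_gamF.le_slope_of_hasDerivWithinAt_Ioi self_mem_Ici
      (mem_Ici.2 hv) h forceTheta_hasDerivWithinAt_gamF
    rw [slope_def_field, le_div_iff₀ (by linarith), forceTheta_gamF_of_le (by norm_num) le_rfl] at h1
    have h2 := mul_le_mul_of_nonneg_right forceTheta_neg_BF_le (by linarith : (0 : ℝ) ≤ v - 3 / 2)
    linarith

/-- **Supporting lines of `gamF`** on `(0, ∞)`: slope `-BF` at `r ≤ 3/2`, `G'(r)` at `r > 3/2`. [folklore] -/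
theorem forceTheta_exists_support {r : ℝ} (hr : 0 < r) :
    ∃ m : ℝ, ∀ v, 0 < v → gamF r + m * (v - r) ≤ gamF v := by
  rcases le_or_gt r (3 / 2) with hru | hru
  · refine ⟨-BF, fun v hv ↦ ?_⟩
    rw [forceTheta_gamF_of_le hr hru]
    rcases le_or_gt v (3 / 2) with hvu | hvu
    · rw [forceTheta_gamF_of_le hv hvu]
      linarith
    · have := forceTheta_line_le_gamF hvu.le
      linarith
  · refine ⟨-10 * r⁻¹ ^ 6 + 11 * r⁻¹ ^ 12 + 12 / 25 * (-6 * r⁻¹ ^ 7 + 12 * r⁻¹ ^ 13),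
      fun v hv ↦ ?_⟩
    rcases le_or_gt v (3 / 2) with hvu | hvu
    · rw [forceTheta_gamF_of_le hv hvu]
      have h1 := forceTheta_tangent_le hru (le_refl (3 / 2 : ℝ))
      rw [forceTheta_gamF_of_le (by norm_num) le_rfl] at h1
      have h2 := mul_le_mul_of_nonpos_right (forceTheta_neg_BF_le_deriv hru)
        (by linarith : v - 3 / 2 ≤ 0)
      linarith
    · exact forceTheta_tangent_le hru hvu.le

/-- **(a) Midpoint inequality** (convexity of `gamF`, i.e. subharmonicity of `thetaF(‖x‖)` on
`ℝ³ ∖ 0`): `2 gamF(r) ≤ gamF(r + s) + gamF(r - s)` for `0 ≤ s < r`. [folklore] -/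
theorem forceTheta_two_mul_gamF_le {r s : ℝ} (hs : 0 ≤ s) (hsr : s < r) :
    2 * gamF r ≤ gamF (r + s) + gamF (r - s) := by
  obtain ⟨m, hm⟩ := forceTheta_exists_support (hs.trans_lt hsr)
  have h1 := hm (r + s) (by linarith)
  have h2 := hm (r - s) (by linarith)
  linarith

/-- The degree-13 Bernstein hint list on `[lo, hi]`: `(v - lo)^k (hi - v)^(13-k) ≥ 0`. [folklore] -/
theorem forceTheta_bernstein {lo hi v : ℝ} (h1 : lo ≤ v) (h2 : v ≤ hi) :
    0 ≤ (v - lo) ^ 0 * (hi - v) ^ 13 ∧ 0 ≤ (v - lo) ^ 1 * (hi - v) ^ 12 ∧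
    0 ≤ (v - lo) ^ 2 * (hi - v) ^ 11 ∧ 0 ≤ (v - lo) ^ 3 * (hi - v) ^ 10 ∧
    0 ≤ (v - lo) ^ 4 * (hi - v) ^ 9 ∧ 0 ≤ (v - lo) ^ 5 * (hi - v) ^ 8 ∧
    0 ≤ (v - lo) ^ 6 * (hi - v) ^ 7 ∧ 0 ≤ (v - lo) ^ 7 * (hi - v) ^ 6 ∧
    0 ≤ (v - lo) ^ 8 * (hi - v) ^ 5 ∧ 0 ≤ (v - lo) ^ 9 * (hi - v) ^ 4 ∧
    0 ≤ (v - lo) ^ 10 * (hi - v) ^ 3 ∧ 0 ≤ (v - lo) ^ 11 * (hi - v) ^ 2 ∧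
    0 ≤ (v - lo) ^ 12 * (hi - v) ^ 1 ∧ 0 ≤ (v - lo) ^ 13 * (hi - v) ^ 0 := by
  have hu : 0 ≤ v - lo := by linarith
  have hw : 0 ≤ hi - v := by linarith
  refine ⟨?_, ?_, ?_, ?_, ?_, ?_, ?_, ?_, ?_, ?_, ?_, ?_, ?_, ?_⟩ <;>
    exact mul_nonneg (pow_nonneg hu _) (pow_nonneg hw _)

/-- **(b) Majorisation** `kF ≤ thetaF` on `[1/2, ∞)`: `v¹³ (AF/v - BF - kF v)` is a polynomial
`≥ 0` on `[1/2, 1]`, resp. `[1, 5/4]`, `[5/4, 3/2]` (it vanishes at `3/2`); `=` beyond. [folklore] -/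
theorem forceTheta_kF_le_thetaF {v : ℝ} (hv : 1 / 2 ≤ v) : kF v ≤ thetaF v := by
  have hv0 : 0 < v := by linarith
  rcases lt_or_ge (3 / 2) v with hvu | hvu
  · rw [forceTheta_thetaF_of_ge hvu.le]
  rw [forceTheta_thetaF_of_le hvu, ← sub_nonneg]
  have h13 : 0 < v ^ 13 := by positivity
  rcases le_total v 1 with hv1 | hv1
  · have e : AF / v - BF - kF v =
        (AF * v ^ 12 - BF * v ^ 13 - 2 * v ^ 7 + v - 12 / 25 + 12 / 25 * v ^ 6) / v ^ 13 := by
      rw [forceTheta_kF_of_le_one hv0 hv1]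
      field_simp
      ring
    rw [e]
    refine div_nonneg ?_ h13.le
    obtain ⟨c0, c1, c2, c3, c4, c5, c6, c7, c8, c9, c10, c11, c12, c13⟩ := forceTheta_bernstein hv hv1
    unfold AF BF
    linarith
  · have e : AF / v - BF - kF v =
        (AF * v ^ 12 - BF * v ^ 13 - 2 * v ^ 7 + v + 12 / 25 - 12 / 25 * v ^ 6) / v ^ 13 := by
      rw [forceTheta_kF_of_one_le hv1]
      field_simp
      ring
    rw [e]
    refine div_nonneg ?_ h13.le
    unfold AF BF
    rcases le_total v (5 / 4) with h54 | h54
    · obtain ⟨c0, c1, c2, c3, c4, c5, c6, c7, c8, c9, c10, c11, c12, c13⟩ := forceTheta_bernstein hv1 h54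
      linarith
    · obtain ⟨c0, c1, c2, c3, c4, c5, c6, c7, c8, c9, c10, c11, c12, c13⟩ := forceTheta_bernstein h54 hvu
      linarith

/-- **(c)** `0 ≤ thetaF` on `(0, ∞)` (`AF/(3/2) > BF`; `2v⁷ ≥ v`, `v⁶ ≥ 1` beyond `3/2`). [folklore] -/
theorem forceTheta_thetaF_nonneg {v : ℝ} (hv : 0 < v) : 0 ≤ thetaF v := by
  rcases le_or_gt v (3 / 2) with hvu | hvu
  · rw [forceTheta_thetaF_of_le hvu, sub_nonneg, le_div_iff₀ hv]
    unfold AF BF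
    linarith
  · rw [forceTheta_thetaF_of_ge hvu.le, forceTheta_kF_of_one_le (by linarith)]
    refine div_nonneg ?_ (by positivity)
    have h6 : 1 ≤ v ^ 6 := one_le_pow₀ (by linarith)
    nlinarith

/-- **(d)** `thetaF ≤ 3` on `[16/25, ∞)` (`AF/(16/25) - BF = 111086159/37791360`; beyond `3/2`,
`2v⁷ + (12/25)v⁶ ≤ 3v¹³`). [folklore] -/
theorem forceTheta_thetaF_le_three {v : ℝ} (hv : 16 / 25 ≤ v) : thetaF v ≤ 3 := by
  rcases le_or_gt v (3 / 2) with hvu | hvu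
  · rw [forceTheta_thetaF_of_le hvu]
    have h1 : AF / v ≤ AF / (16 / 25) :=
      div_le_div_of_nonneg_left (by unfold AF; norm_num) (by norm_num) hv
    have h2 : AF / (16 / 25) - BF ≤ 3 := by unfold AF BF; norm_num
    linarith
  · rw [forceTheta_thetaF_of_ge hvu.le, forceTheta_kF_of_one_le (by linarith),
      div_le_iff₀ (by positivity)]
    have h6 : (11 : ℝ) ≤ v ^ 6 := le_trans (by norm_num) (pow_le_pow_left₀ (by norm_num) hvu.le 6)
    have h7 : (0 : ℝ) ≤ v ^ 7 := by positivity
    have h67 : v ^ 6 ≤ v ^ 7 := pow_le_pow_right₀ (by linarith) (by norm_num)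
    nlinarith [mul_le_mul_of_nonneg_right h6 h7]

/-- **(e)** `thetaF` is measurable. [folklore] -/
theorem forceTheta_measurable : Measurable thetaF := by
  unfold thetaF kF hLJ hLJ'
  refine Measurable.ite measurableSet_Iic ?_ ?_ <;> fun_prop

/-- **(f) Drop threshold** `kF ≤ 0` on `[0.684, 4/5]` (`2v⁷ - v + (12/25)(1 - v⁶) ≤ 0`). [folklore] -/
theorem forceTheta_kF_nonpos {v : ℝ} (h1 : 171 / 250 ≤ v) (h2 : v ≤ 4 / 5) : kF v ≤ 0 := by
  rw [forceTheta_kF_of_le_one (by linarith) (by linarith)]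
  refine div_nonpos_of_nonpos_of_nonneg ?_ (by positivity)
  obtain ⟨c0, c1, c2, c3, c4, c5, c6, c7, c8, c9, c10, c11, c12, c13⟩ := forceTheta_bernstein h1 h2
  linarith

/-- `v² thetaF(v)` is interval integrable on `[a, b] ⊆ [16/25, ∞)` (bounded by `3b²`). [folklore] -/
theorem forceTheta_intervalIntegrable {a b : ℝ} (ha : 16 / 25 ≤ a) (hab : a ≤ b) :
    IntervalIntegrable (fun v ↦ v ^ 2 * thetaF v) volume a b := by
  refine (intervalIntegrable_const (c := b ^ 2 * 3)).mono_fun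
    ((measurable_id.pow_const 2).mul forceTheta_measurable).aestronglyMeasurable ?_
  rw [Filter.EventuallyLE, ae_restrict_iff' measurableSet_uIoc]
  refine Filter.Eventually.of_forall fun v hv ↦ ?_
  rw [uIoc_of_le hab] at hv
  have hv1 : 16 / 25 ≤ v := ha.trans hv.1.le
  have hv0 : 0 < v := lt_of_lt_of_le (by norm_num) hv1
  show ‖v ^ 2 * thetaF v‖ ≤ ‖b ^ 2 * (3 : ℝ)‖
  rw [Real.norm_of_nonneg (mul_nonneg (sq_nonneg v) (forceTheta_thetaF_nonneg hv0)),
    Real.norm_of_nonneg (by positivity)]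
  exact mul_le_mul (pow_le_pow_left₀ hv0.le hv.2 2) (forceTheta_thetaF_le_three hv1)
    (forceTheta_thetaF_nonneg hv0) (sq_nonneg b)

/-- Linear part: `∫_{16/25}^{3/2} v² thetaF = ∫ (AF v - BF v²) = 266031117181/295245000000`. [folklore] -/
theorem forceTheta_integral_lin :
    ∫ v in (16 / 25 : ℝ)..(3 / 2), v ^ 2 * thetaF v = 266031117181 / 295245000000 := by
  have hle : (16 / 25 : ℝ) ≤ 3 / 2 := by norm_num
  have hderiv : ∀ v ∈ uIcc (16 / 25 : ℝ) (3 / 2),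
      HasDerivAt (fun v : ℝ ↦ AF * v ^ 2 / 2 - BF * v ^ 3 / 3) (v ^ 2 * thetaF v) v := by
    intro v hv
    rw [uIcc_of_le hle] at hv
    have hv0 : (0 : ℝ) < v := lt_of_lt_of_le (by norm_num) hv.1
    have h := ((((hasDerivAt_id' v).fun_pow 2).const_mul AF).div_const 2).fun_sub
      ((((hasDerivAt_id' v).fun_pow 3).const_mul BF).div_const 3)
    refine h.congr_deriv ?_
    rw [forceTheta_thetaF_of_le hv.2]
    field_simp
    ring
  rw [integral_eq_sub_of_hasDerivAt hderiv (forceTheta_intervalIntegrable le_rfl hle)]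
  unfold AF BF
  norm_num

/-- Tail: `∫_{3/2}^{R} v² thetaF = F(R) - F(3/2)` (`v² thetaF = 2v⁻⁴ - v⁻¹⁰ + (12/25)(v⁻⁵ - v⁻¹¹)`
there), `F(v) = -(2/3)v⁻³ + (1/9)v⁻⁹ + (12/25)(-v⁻⁴/4 + v⁻¹⁰/10)`, `-F(3/2) = 4816448/22143375`. [folklore] -/
theorem forceTheta_integral_tail {R : ℝ} (hR : 3 / 2 ≤ R) :
    ∫ v in (3 / 2 : ℝ)..R, v ^ 2 * thetaF v =
      -(2 / 3 * R⁻¹ ^ 3) + 1 / 9 * R⁻¹ ^ 9 + 12 / 25 * (-(1 / 4 * R⁻¹ ^ 4) + 1 / 10 * R⁻¹ ^ 10) +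
        4816448 / 22143375 := by
  have hderiv : ∀ v ∈ uIcc (3 / 2) R, HasDerivAt (fun v : ℝ ↦ -(2 / 3 * v⁻¹ ^ 3) +
      1 / 9 * v⁻¹ ^ 9 + 12 / 25 * (-(1 / 4 * v⁻¹ ^ 4) + 1 / 10 * v⁻¹ ^ 10))
      (v ^ 2 * thetaF v) v := by
    intro v hv
    rw [uIcc_of_le hR] at hv
    have hv0 : (0 : ℝ) < v := lt_of_lt_of_le (by norm_num) hv.1
    have hi : HasDerivAt (fun y : ℝ ↦ y⁻¹) (-(v ^ 2)⁻¹) v := hasDerivAt_inv hv0.ne'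
    have h := ((((hi.fun_pow 3).const_mul (2 / 3)).fun_neg).fun_add
      ((hi.fun_pow 9).const_mul (1 / 9))).fun_add
      (((((hi.fun_pow 4).const_mul (1 / 4)).fun_neg).fun_add
        ((hi.fun_pow 10).const_mul (1 / 10))).const_mul (12 / 25))
    refine h.congr_deriv ?_
    rw [forceTheta_thetaF_of_ge hv.1, kF, abs_of_nonpos (forceTheta_hLJ'_nonpos (by linarith [hv.1])),
      hLJ, hLJ']
    norm_num
    field_simp
    ring
  rw [integral_eq_sub_of_hasDerivAt hderiv (forceTheta_intervalIntegrable (by norm_num) hR)]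
  norm_num

/-- **(g) The mass bound** `∫_{16/25}^{R} v² thetaF(v) dv ≤ 28/25` for every `R ≥ 3/2`. [folklore] -/
theorem forceTheta_integral_le {R : ℝ} (hR : 3 / 2 ≤ R) :
    ∫ v in (16 / 25 : ℝ)..R, v ^ 2 * thetaF v ≤ 28 / 25 := by
  have hle : (16 / 25 : ℝ) ≤ 3 / 2 := by norm_num
  have hR0 : 0 < R := by linarith
  rw [← integral_add_adjacent_intervals (b := 3 / 2) (forceTheta_intervalIntegrable le_rfl hle)
    (forceTheta_intervalIntegrable hle hR), forceTheta_integral_lin, forceTheta_integral_tail hR]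
  have h0 : 0 ≤ R⁻¹ := inv_nonneg.2 hR0.le
  have h1 : R⁻¹ ≤ 1 := inv_le_one_of_one_le₀ (by linarith)
  linarith [pow_nonneg h0 3, pow_nonneg h0 4, pow_le_pow_of_le_one h0 h1 (by norm_num : 3 ≤ 9),
    pow_le_pow_of_le_one h0 h1 (by norm_num : 4 ≤ 10)]

/-- **One-variable facts about the majorant `thetaF`** (registered stub `stub_forceTheta`, line
`Sketch`, crux `LjLaminarWindows`): (a) midpoint convexity of `gamF`, (b) `kF ≤ thetaF` on `[1/2, ∞)`,
(c) `0 ≤ thetaF` on `(0, ∞)`, (d) `thetaF ≤ 3` on `[16/25, ∞)`, (e) measurability, (f) `kF ≤ 0` on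
`[0.684, 4/5]`, (g) `∫_{16/25}^{R} v² thetaF ≤ 28/25` for `R ≥ 3/2`. [folklore] -/
theorem stub_forceTheta : ForceThetaFacts := by
  unfold ForceThetaFacts
  exact ⟨fun r s hs hsr ↦ forceTheta_two_mul_gamF_le hs hsr, fun v hv ↦ forceTheta_kF_le_thetaF hv,
    fun v hv ↦ forceTheta_thetaF_nonneg hv, fun v hv ↦ forceTheta_thetaF_le_three hv,
    forceTheta_measurable, fun v h1 h2 ↦ forceTheta_kF_nonpos h1 h2,
    fun R hR ↦ forceTheta_integral_le hR⟩

end Summit.AtomisticToContinuum.Crystallization.Theorems.LjLaminarWindowsSketch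

end
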